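/-
Copyright (c) 2026. All rights reserved.
Released under Apache 2.0 license as described in the file LICENSE.
Authors: abc-iut cell, seat abc-iut-w5-d050 (gen 5).
-/
import Literature.GroupTheory.StronglyCompleteExtension
import Literature.GroupTheory.ProPStronglyComplete

/-!
# Virtually strongly complete profinite groups; virtually pro-`p` groups

A profinite group is *strongly complete* when every subgroup of finite index is open (L. Ribes,
P. Zalesskii, *Profinite Groups*, §4.2; the property is spelled out as a hypothesis — no definition).
This proof-only file adds to abc-iut-w5-d218's extension lemma (`isOpen_of_finiteIndex_of_extension`,
`StronglyCompleteExtension.lean`) and to Serre's theorem for topologically finitely generated pro-`p`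
groups (`isOpen_of_finiteIndex_of_proP`, `ProPStronglyComplete.lean`; J. D. Dixon et al., *Analytic
pro-`p` groups*, Thm. 1.17) the three standard corollaries:

* `isOpen_of_finiteIndex_of_isOpen_normal` — "VIRTUALLY strongly complete ⟹ strongly complete": an OPEN
  normal subgroup with all finite-index subgroups open suffices (the quotient is finite and discrete);
* `isOpen_of_finiteIndex_subgroup_of_finiteIndex` — finite-index (hence open) subgroups of strongly
  complete groups are strongly complete;
* `isOpen_of_finiteIndex_of_isOpen_normal_proP` — **a profinite group with an OPEN NORMAL subgroup that is
  a topologically finitely generated pro-`p` group has every finite-index subgroup open** (e.g. compact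
  `p`-adic analytic groups; virtually pro-`l` fundamental groups), with the continuity form
  `continuous_of_isOpen_normal_proP`.

[cite: RibesZalesskii2010, §4.2] [cite: DixonEtAl1999, §1.3 Theorem 1.17]
-/

namespace Literature.GroupTheory

namespace StronglyCompleteVirtual

universe u

variable {G : Type u} [Group G] [TopologicalSpace G] [IsTopologicalGroup G] [CompactSpace G]
  [TotallyDisconnectedSpace G]

/-- **Virtually strongly complete ⟹ strongly complete.** If an OPEN normal subgroup `K` of a profinite
group `G` has all its finite-index subgroups open (subspace topology), then every finite-index subgroup of
`G` is open: the quotient `G ⧸ K` is finite and discrete, so abc-iut-w5-d218's extension lemma applies.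
[cite: RibesZalesskii2010, §4.2] -/
theorem isOpen_of_finiteIndex_of_isOpen_normal (K : Subgroup G) [K.Normal] (hKo : IsOpen (K : Set G))
    (hK : ∀ V : Subgroup K, V.FiniteIndex → IsOpen (V : Set K))
    (H : Subgroup G) [H.FiniteIndex] : IsOpen (H : Set G) :=
  haveI : DiscreteTopology (G ⧸ K) := QuotientGroup.discreteTopology hKo
  isOpen_of_finiteIndex_of_extension K hK (fun _ _ => isOpen_discrete _) H

omit [IsTopologicalGroup G] [CompactSpace G] [TotallyDisconnectedSpace G] in
/-- **Finite-index subgroups of strongly complete groups are strongly complete**: a finite-index subgroup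
`U` of a finite-index subgroup `K` has finite index `[G : K]·[K : U]` in `G`, hence is open in `G`, hence
in `K`. [cite: RibesZalesskii2010, §4.2] -/
theorem isOpen_of_finiteIndex_subgroup_of_finiteIndex
    (hG : ∀ H : Subgroup G, H.FiniteIndex → IsOpen (H : Set G))
    (K : Subgroup G) [K.FiniteIndex] (U : Subgroup K) [U.FiniteIndex] : IsOpen (U : Set K) := by
  have hUG : (U.map K.subtype).FiniteIndex := by
    constructor
    rw [← Subgroup.relIndex_mul_index (Subgroup.map_subtype_le U), Subgroup.relIndex,
      Subgroup.subgroupOf, Subgroup.comap_map_eq_self_of_injective K.subtype_injective]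
    exact mul_ne_zero Subgroup.FiniteIndex.index_ne_zero Subgroup.FiniteIndex.index_ne_zero
  have hopen : IsOpen ((U.map K.subtype : Subgroup G) : Set G) := hG _ hUG
  have hset : (U : Set K) = Subtype.val ⁻¹' ((U.map K.subtype : Subgroup G) : Set G) := by
    ext u
    simp only [SetLike.mem_coe, Set.mem_preimage, Subgroup.mem_map, Subgroup.coe_subtype]
    constructor
    · exact fun hu => ⟨u, hu, rfl⟩
    · rintro ⟨v, hv, hvu⟩
      exact (Subtype.ext hvu : v = u) ▸ hv
  rw [hset]
  exact hopen.preimage continuous_subtype_val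

/-- **Virtually (topologically finitely generated pro-`p`) profinite groups are strongly complete**: if a
profinite group `G` has an OPEN NORMAL subgroup `K` which, in the subspace topology, is pro-`p` (every
quotient by an open normal subgroup of `K` is a `p`-group) and topologically finitely generated, then
every finite-index subgroup of `G` is open — Serre's theorem for `K` (`isOpen_of_finiteIndex_of_proP`,
abc-iut-w5-d218) plus `isOpen_of_finiteIndex_of_isOpen_normal`.
[cite: DixonEtAl1999, §1.3 Theorem 1.17] -/
theorem isOpen_of_finiteIndex_of_isOpen_normal_proP {p : ℕ} [Fact p.Prime]
    (K : Subgroup G) [K.Normal] (hKo : IsOpen (K : Set G))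
    (hP : ∀ U : OpenNormalSubgroup K, IsPGroup p (K ⧸ (U : Subgroup K)))
    (hfg : ∃ S : Finset K, Dense ((Subgroup.closure (S : Set K) : Subgroup K) : Set K))
    (H : Subgroup G) [H.FiniteIndex] : IsOpen (H : Set G) := by
  haveI : CompactSpace K := isCompact_iff_compactSpace.mp (K.isClosed_of_isOpen hKo).isCompact
  exact isOpen_of_finiteIndex_of_isOpen_normal K hKo
    (fun V hV => by
      haveI := hV
      exact isOpen_of_finiteIndex_of_proP hP hfg V) H

/-- Continuity form: every homomorphism from a virtually (topologically finitely generated pro-`p`)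
profinite group to a profinite group is continuous. [cite: DixonEtAl1999, §1.3 Theorem 1.17] -/
theorem continuous_of_isOpen_normal_proP {p : ℕ} [Fact p.Prime]
    (K : Subgroup G) [K.Normal] (hKo : IsOpen (K : Set G))
    (hP : ∀ U : OpenNormalSubgroup K, IsPGroup p (K ⧸ (U : Subgroup K)))
    (hfg : ∃ S : Finset K, Dense ((Subgroup.closure (S : Set K) : Subgroup K) : Set K))
    {L : Type*} [Group L] [TopologicalSpace L] [IsTopologicalGroup L] [CompactSpace L]
    [TotallyDisconnectedSpace L] (f : G →* L) : Continuous f := by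
  apply continuous_of_continuousAt_one f
  rw [ContinuousAt, map_one]
  intro V hV
  obtain ⟨N, hN⟩ := ProfiniteGrp.exist_openNormalSubgroup_sub_open_nhds_of_one
    (isOpen_interior (s := V)) (mem_interior_iff_mem_nhds.mpr hV)
  haveI : Finite (L ⧸ N.toSubgroup) := N.toSubgroup.quotient_finite_of_isOpen N.isOpen'
  haveI : N.toSubgroup.FiniteIndex := Subgroup.finiteIndex_of_finite_quotient
  have hfin : (N.toSubgroup.comap f).FiniteIndex := by
    constructor
    intro h0
    have hdvd := Subgroup.index_comap N.toSubgroup f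
    rw [h0] at hdvd
    -- relIndex of N on f.range is nonzero (N has finite index)
    exact Subgroup.FiniteIndex.index_ne_zero
      (Nat.eq_zero_of_zero_dvd (hdvd ▸ Subgroup.relIndex_dvd_index_of_normal N.toSubgroup f.range))
  have hopen : IsOpen ((N.toSubgroup.comap f : Subgroup G) : Set G) :=
    isOpen_of_finiteIndex_of_isOpen_normal_proP K hKo hP hfg _
  exact Filter.mem_of_superset (hopen.mem_nhds (Subgroup.one_mem _))
    (fun x hx => interior_subset (hN hx))

end StronglyCompleteVirtual

end Literature.GroupTheory
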